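import Summits.AnomalousDissipation.AnomalousDissipation.Theses.RootDecompCycle2B
import Literature.Analysis.FunctionSpaces.TorusTrigPoly
import Literature.Analysis.FluidPDE.DoeringFoiasProofs
import Literature.Analysis.FluidPDE.LerayHopfSpectralMeasurability
import Literature.Analysis.FluidPDE.NSUniqueness2HalfD
import Literature.Analysis.FluidPDE.StatisticalSolutionEnergyEq
import Literature.Analysis.FluidPDE.DuchonRobertLionsEnergyEquality
import Literature.Analysis.FluidPDE.LongTimeAverageSubadditive
import Literature.Analysis.FluidPDE.TimeAverageEnstrophy
import Literature.Analysis.FluidPDE.LerayHopfMomentum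
import Literature.Analysis.FunctionSpaces.TorusTruncationH1
import Literature.Analysis.FluidPDE.LerayHopfRestartTorus
import Literature.Analysis.FluidPDE.LongTimeAverageShift
import Literature.Analysis.FluidPDE.LerayHopfUniformEnergyMomentum
import Literature.Analysis.FluidPDE.AlexakisDoeringInterpolation

/-!
# `RootDecompCycle2B.TaylorBridge` (stmt-AnomalousDissipation-26917) is a theorem

The support item W_T of `route-AnomalousDissipation-RootDecompCycle2B` (shared with ReynoldsLanding): if loud stretches are
landed in TAYLOR BOXES — running means of the box energy `‖P_{K_j} u‖²` with `ν_j (K_j² + 1) ≥ 1` bounded by `E` on loud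
stretches starting at `T₀ ≥ 1` — then they are landed outright, with full running-mean energy `≤ 4E + E₀ + ‖f‖₂²`.
Quantitative heart (`timeMean_energy_le_of_timeMean_lowEnergy_le`): high modes are slaved to the dissipation by the spectral
Poincaré inequality on the tail `‖(1 − P_K)u‖² ≤ ‖∇u‖²/(4π²(K² + 1))`, the dissipation is paid by `E₀/2 + ∫⟪f, u⟫`
(Leray–Hopf energy inequality), the power by Young `⟪f,u⟫ ≤ ½‖f‖² + ½‖u‖²`, and with `ν(K²+1) ≥ 1` the energy feedback has
coefficient `≤ 1/(2π²) ≤ ½` and is absorbed (FMRT Ch. IV (5.27)-type bookkeeping).  Every ingredient is a tree lemma.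
Source: decomp-ad cell, lens-5 node «ReynoldsLanding» / «TaylorLanding» (kernel
`run/shared/lean/pub/decomp-ad/decomp-ad-lens-5/ReynoldsLanding.lean` §Analysis + `taylorBridge_holds`, by name against the tree);
landed by the cell's prover seat with the kernel's abbreviations `energyMean` / `lowEnergyMean` inlined.  Nothing here proves the summit.
-/

set_option linter.dupNamespace false

noncomputable section

namespace Summit.AnomalousDissipation.AnomalousDissipation.Theorems.TaylorBridge

open MeasureTheory Filter Topology Set
open scoped InnerProductSpace
open Literature.Analysis.FunctionSpaces Literature.Analysis.FluidPDE
open Summit.AnomalousDissipation.AnomalousDissipation.Theses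

variable {ν : ℝ} {f u₀ : UnitAddTorus (Fin 3) → EuclideanSpace ℝ (Fin 3)} {u : ℝ → UnitAddTorus (Fin 3) → EuclideanSpace ℝ (Fin 3)}


/-- Pointwise-in-time spectral splitting: `‖v‖₂² ≤ 2‖P_K v‖₂² + 2‖∇v‖₂²/(4π²(K²+1))`
(`v = P_K v + (v - P_K v)` and the spectral Poincaré inequality on the tail `|k| > K`). [folklore] -/
theorem integral_norm_sq_le_low_add_grad {v : (UnitAddTorus (Fin 3)) → (EuclideanSpace ℝ (Fin 3))} (hv : MemLp v 2 volume) (K : ℕ)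
    (hfin : Torus.eGradNormSq v ≠ ⊤) :
    ∫ x, ‖v x‖ ^ 2 ≤ 2 * (∫ x, ‖Torus.fourierTruncate K v x‖ ^ 2) +
      2 / (4 * Real.pi ^ 2 * ((K : ℝ) ^ 2 + 1)) * (Torus.eGradNormSq v).toReal := by
  have htail : Torus.tailGradNormSq K v ≠ ⊤ := ne_top_of_le_ne_top hfin (Torus.tailGradNormSq_le K v)
  have h1 := Torus.integral_norm_sq_fourierTruncate_sub_le hv K htail
  have h2 : (Torus.tailGradNormSq K v).toReal ≤ (Torus.eGradNormSq v).toReal :=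
    ENNReal.toReal_mono hfin (Torus.tailGradNormSq_le K v)
  have hpos : 0 < 4 * Real.pi ^ 2 * ((K : ℝ) ^ 2 + 1) := by positivity
  have h3 : ∫ x, ‖Torus.fourierTruncate K v x - v x‖ ^ 2 ≤
      (Torus.eGradNormSq v).toReal / (4 * Real.pi ^ 2 * ((K : ℝ) ^ 2 + 1)) :=
    h1.trans (div_le_div_of_nonneg_right h2 hpos.le)
  have hPv : MemLp (Torus.fourierTruncate K v) 2 volume := Torus.memLp_fourierTruncate K v 2
  have hiv : Integrable (fun x => ‖v x‖ ^ 2) volume := hv.integrable_norm_pow two_ne_zero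
  have hiP : Integrable (fun x => ‖Torus.fourierTruncate K v x‖ ^ 2) volume :=
    hPv.integrable_norm_pow two_ne_zero
  have hiD : Integrable (fun x => ‖Torus.fourierTruncate K v x - v x‖ ^ 2) volume :=
    (hPv.sub hv).integrable_norm_pow two_ne_zero
  have h4 : ∫ x, ‖v x‖ ^ 2 ≤ ∫ x, (2 * ‖Torus.fourierTruncate K v x‖ ^ 2 +
      2 * ‖Torus.fourierTruncate K v x - v x‖ ^ 2) := by
    refine integral_mono hiv ((hiP.const_mul 2).add (hiD.const_mul 2)) fun x => ?_
    have hx : v x = Torus.fourierTruncate K v x - (Torus.fourierTruncate K v x - v x) := by abel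
    have := norm_sub_le (Torus.fourierTruncate K v x) (Torus.fourierTruncate K v x - v x)
    rw [← hx] at this
    have hsq : ‖v x‖ ^ 2 ≤ (‖Torus.fourierTruncate K v x‖ + ‖Torus.fourierTruncate K v x - v x‖) ^ 2 :=
      pow_le_pow_left₀ (norm_nonneg _) this 2
    nlinarith [hsq, sq_nonneg (‖Torus.fourierTruncate K v x‖ - ‖Torus.fourierTruncate K v x - v x‖)]
  rw [integral_add (hiP.const_mul 2) (hiD.const_mul 2), integral_const_mul, integral_const_mul] at h4
  have h5 : 2 * (∫ x, ‖Torus.fourierTruncate K v x - v x‖ ^ 2) ≤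
      2 / (4 * Real.pi ^ 2 * ((K : ℝ) ^ 2 + 1)) * (Torus.eGradNormSq v).toReal := by
    rw [div_mul_eq_mul_div, le_div_iff₀ hpos]
    rw [le_div_iff₀ hpos] at h3
    nlinarith [h3]
  linarith [h4, h5]

/-- Power Young inequality: `∫⟪f, v⟫ ≤ ½‖f‖₂² + ½‖v‖₂²` for smooth `f` and `v ∈ L²`. [folklore] -/
theorem integral_inner_le_half_add_half {v : (UnitAddTorus (Fin 3)) → (EuclideanSpace ℝ (Fin 3))} (hf : Torus.IsSmooth f) (hv : MemLp v 2 volume) :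
    ∫ x, ⟪f x, v x⟫_ℝ ≤ 2⁻¹ * (∫ x, ‖f x‖ ^ 2) + 2⁻¹ * ∫ x, ‖v x‖ ^ 2 := by
  have hiv : Integrable (fun x => ‖v x‖ ^ 2) volume := hv.integrable_norm_pow two_ne_zero
  have hif : Integrable (fun x => ‖f x‖ ^ 2) volume := (hf.memLp 2).integrable_norm_pow two_ne_zero
  have hinner : Integrable (fun x => ⟪f x, v x⟫_ℝ) volume := by
    have h := Torus.integrable_inner_of_continuous (hv.integrable one_le_two) hf.continuous
    refine h.congr (ae_of_all _ fun x => ?_)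
    exact real_inner_comm _ _
  calc ∫ x, ⟪f x, v x⟫_ℝ ≤ ∫ x, (2⁻¹ * ‖f x‖ ^ 2 + 2⁻¹ * ‖v x‖ ^ 2) := by
        refine integral_mono hinner ((hif.const_mul _).add (hiv.const_mul _)) fun x => ?_
        have h1 := real_inner_le_norm (f x) (v x)
        nlinarith [h1, two_mul_le_add_sq ‖f x‖ ‖v x‖]
    _ = 2⁻¹ * (∫ x, ‖f x‖ ^ 2) + 2⁻¹ * ∫ x, ‖v x‖ ^ 2 := by
        rw [integral_add (hif.const_mul _) (hiv.const_mul _), integral_const_mul, integral_const_mul]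

/-- Along a Leray–Hopf solution on `[0,T]` the low-mode energy `t ↦ ‖P_K u(t)‖₂²` is integrable on
`(0,T]` (measurable through the mode amplitudes, dominated by the energy). [folklore] -/
theorem integrableOn_lowEnergy {T : ℝ} {F : ℝ → (UnitAddTorus (Fin 3)) → (EuclideanSpace ℝ (Fin 3))}
    (hu : Torus.IsLerayHopfOn T ν F u₀ u) (K : ℕ) :
    IntegrableOn (fun t => ∫ x, ‖Torus.fourierTruncate K (u t) x‖ ^ 2) (Ioc 0 T) := by
  rw [integrableOn_Ioc_iff_integrableOn_Ioo]
  have hmeas : AEStronglyMeasurable (fun t => ∫ x, ‖Torus.fourierTruncate K (u t) x‖ ^ 2)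
      (volume.restrict (Ioo 0 T)) := by
    have hsum : AEStronglyMeasurable (fun t => ∑ k ∈ Torus.freqBall K,
        ‖UnitAddTorus.mFourierCoeff (EuclideanSpace.complexify ∘ u t) k‖ ^ 2) (volume.restrict (Ioo 0 T)) := by
      have hk : ∀ k ∈ Torus.freqBall (d := Fin 3) K, AEStronglyMeasurable
          (fun t => ‖UnitAddTorus.mFourierCoeff (EuclideanSpace.complexify ∘ u t) k‖ ^ 2)
          (volume.restrict (Ioo 0 T)) := fun k _ =>
        (continuous_norm.pow 2).comp_aestronglyMeasurable (hu.aestronglyMeasurable_mFourierCoeff k)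
      have h := Finset.aestronglyMeasurable_sum (μ := volume.restrict (Ioo 0 T))
        (f := fun k t => ‖UnitAddTorus.mFourierCoeff (EuclideanSpace.complexify ∘ u t) k‖ ^ 2)
        (Torus.freqBall (d := Fin 3) K) hk
      refine h.congr (ae_of_all _ fun t => ?_)
      simp only [Finset.sum_apply]
    refine hsum.congr ?_
    filter_upwards [ae_restrict_mem measurableSet_Ioo] with t ht
    exact (Torus.integral_norm_sq_fourierTruncate
      ((hu.memLp t (Ioo_subset_Icc_self ht)).integrable one_le_two) K).symm
  refine Integrable.mono' hu.integrableOn_integral_norm_sq hmeas ?_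
  filter_upwards [ae_restrict_mem measurableSet_Ioo] with t ht
  rw [Real.norm_eq_abs, abs_of_nonneg (integral_nonneg fun x => by positivity)]
  exact Torus.integral_norm_sq_fourierTruncate_le (hu.memLp t (Ioo_subset_Icc_self ht)) K

/-- **The Taylor bridge at fixed viscosity.** Let `u` be a global Leray–Hopf solution with smooth mean-zero steady force `f`,
`‖u₀‖₂² ≤ E₀`, and let the box `K` satisfy `ν (K² + 1) ≥ 1` (Taylor box). If the running mean over `[0,T]`, `T ≥ 1`, of the box
energy is `≤ E`, then the running mean of the FULL energy is `≤ 4E + E₀ + ‖f‖₂²`. [folklore] -/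
theorem timeMean_energy_le_of_timeMean_lowEnergy_le (hν : 0 < ν) (hf : Torus.IsSmooth f)
    (hf0 : Torus.HasZeroMean f) (hu : Torus.IsGlobalLerayHopf ν (fun _ => f) u₀ u) {K : ℕ}
    (hK : 1 ≤ ν * ((K : ℝ) ^ 2 + 1)) {E₀ E T : ℝ} (hcap : ∫ x, ‖u₀ x‖ ^ 2 ≤ E₀) (hT : 1 ≤ T)
    (hlow : timeMean (fun t => ∫ x, ‖Torus.fourierTruncate K (u t) x‖ ^ 2) T ≤ E) :
    timeMean (fun t => ∫ x, ‖u t x‖ ^ 2) T ≤ 4 * E + E₀ + ∫ x, ‖f x‖ ^ 2 := by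
  have hTpos : 0 < T := one_pos.trans_le hT
  have hLH : Torus.IsLerayHopfOn T ν (fun _ => f) u₀ u := hu T hTpos
  -- the four time integrals
  set IY : ℝ := ∫ t in Ioc 0 T, ∫ x, ‖u t x‖ ^ 2 with hIYdef
  set IL : ℝ := ∫ t in Ioc 0 T, ∫ x, ‖Torus.fourierTruncate K (u t) x‖ ^ 2 with hILdef
  set IG : ℝ := ∫ t in Ioc 0 T, ν * (Torus.eGradNormSq (u t)).toReal with hIGdef
  set IP : ℝ := ∫ t in Ioc 0 T, ∫ x, ⟪f x, u t x⟫_ℝ with hIPdef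
  set F2 : ℝ := ∫ x, ‖f x‖ ^ 2 with hF2def
  set c : ℝ := 2 / (4 * Real.pi ^ 2 * ((K : ℝ) ^ 2 + 1)) / ν with hcdef
  -- integrability
  have he_int : IntegrableOn (fun t => ∫ x, ‖u t x‖ ^ 2) (Ioc 0 T) := by
    rw [integrableOn_Ioc_iff_integrableOn_Ioo]; exact hLH.integrableOn_integral_norm_sq
  have heK_int := integrableOn_lowEnergy hLH K
  have hg_int : IntegrableOn (fun t => ν * (Torus.eGradNormSq (u t)).toReal) (Ioc 0 T) := by
    have h := (hLH.intervalIntegral_dissipation_eq hTpos).1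
    rwa [intervalIntegrable_iff_integrableOn_Ioc_of_le hTpos.le] at h
  have hP_int : IntegrableOn (fun t => ∫ x, ⟪f x, u t x⟫_ℝ) (Ioc 0 T) := by
    have h := hLH.intervalIntegrable_power hTpos hν (hf.memLp 2) hf0
    rwa [intervalIntegrable_iff_integrableOn_Ioc_of_le hTpos.le] at h
  -- signs
  have hF2 : 0 ≤ F2 := integral_nonneg fun x => by positivity
  have hE₀ : 0 ≤ E₀ := (integral_nonneg fun x => by positivity).trans hcap
  have hIY : 0 ≤ IY := setIntegral_nonneg measurableSet_Ioc fun t _ => integral_nonneg fun x => by positivity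
  have hIL : 0 ≤ IL := setIntegral_nonneg measurableSet_Ioc fun t _ => integral_nonneg fun x => by positivity
  have hIG : 0 ≤ IG :=
    setIntegral_nonneg measurableSet_Ioc fun t _ => mul_nonneg hν.le ENNReal.toReal_nonneg
  have hc0 : 0 ≤ c := by positivity
  have hc : c ≤ 2⁻¹ := by
    have hπ : (1 : ℝ) ≤ Real.pi ^ 2 := by nlinarith [Real.pi_gt_three]
    have hden : 0 < 4 * Real.pi ^ 2 * ((K : ℝ) ^ 2 + 1) := by positivity
    rw [hcdef, div_div, div_le_iff₀ (mul_pos hden hν)]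
    nlinarith [hK, hπ, mul_nonneg (sub_nonneg.2 hπ) (le_trans zero_le_one hK)]
  -- (1) spectral splitting integrated in time: IY ≤ 2 IL + c IG
  have h1 : IY ≤ 2 * IL + c * IG := by
    have hae : ∀ᵐ t ∂(volume.restrict (Ioo 0 T)), Torus.eGradNormSq (u t) < ⊤ :=
      ae_lt_top' hLH.aemeasurable_eGradNormSq hLH.lintegral_eGradNormSq_lt_top.ne
    have hae' : ∀ᵐ t ∂(volume.restrict (Ioc 0 T)), ∫ x, ‖u t x‖ ^ 2 ≤
        2 * (∫ x, ‖Torus.fourierTruncate K (u t) x‖ ^ 2) + c * (ν * (Torus.eGradNormSq (u t)).toReal) := by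
      rw [← Measure.restrict_congr_set (Ioo_ae_eq_Ioc (μ := (volume : Measure ℝ)) (a := 0) (b := T))]
      filter_upwards [hae, ae_restrict_mem measurableSet_Ioo] with t ht htmem
      have h := integral_norm_sq_le_low_add_grad (hLH.memLp t (Ioo_subset_Icc_self htmem)) K ht.ne
      have hcν : c * (ν * (Torus.eGradNormSq (u t)).toReal) =
          2 / (4 * Real.pi ^ 2 * ((K : ℝ) ^ 2 + 1)) * (Torus.eGradNormSq (u t)).toReal := by
        rw [hcdef]; field_simp
      rw [hcν]; exact h
    have hint2 : Integrable (fun t => 2 * (∫ x, ‖Torus.fourierTruncate K (u t) x‖ ^ 2) +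
        c * (ν * (Torus.eGradNormSq (u t)).toReal)) (volume.restrict (Ioc 0 T)) :=
      (heK_int.const_mul 2).add (hg_int.const_mul c)
    have h := integral_mono_ae he_int hint2 hae'
    rw [integral_add (heK_int.const_mul 2) (hg_int.const_mul c), integral_const_mul,
      integral_const_mul] at h
    exact h
  -- (2) dissipation budget: IG ≤ E₀/2 + IP
  have h2 : IG ≤ E₀ / 2 + IP := by
    have h := hLH.intervalIntegral_dissipation_le hTpos
    rw [intervalIntegral.integral_of_le hTpos.le, intervalIntegral.integral_of_le hTpos.le] at h
    have hke : Torus.kineticEnergy u₀ ≤ E₀ / 2 := by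
      unfold Torus.kineticEnergy; linarith
    linarith
  -- (3) power Young: IP ≤ T F2/2 + IY/2
  have h3 : IP ≤ T * (2⁻¹ * F2) + 2⁻¹ * IY := by
    have hpt : ∀ t ∈ Ioc 0 T, ∫ x, ⟪f x, u t x⟫_ℝ ≤ 2⁻¹ * F2 + 2⁻¹ * ∫ x, ‖u t x‖ ^ 2 :=
      fun t ht => by
        rw [hF2def]; exact integral_inner_le_half_add_half hf (hLH.memLp t (Ioc_subset_Icc_self ht))
    have hconst : IntegrableOn (fun _ : ℝ => 2⁻¹ * F2) (Ioc 0 T) :=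
      integrableOn_const (by simp [Real.volume_Ioc])
    have hint2 : Integrable (fun t => 2⁻¹ * F2 + 2⁻¹ * ∫ x, ‖u t x‖ ^ 2)
        (volume.restrict (Ioc 0 T)) := hconst.add (he_int.const_mul _)
    have h := setIntegral_mono_on hP_int hint2 measurableSet_Ioc hpt
    have hcI : ∫ _ in Ioc 0 T, (2⁻¹ * F2) = T * (2⁻¹ * F2) := by
      rw [setIntegral_const, Real.volume_real_Ioc_of_le hTpos.le, sub_zero, smul_eq_mul]
    rw [integral_add hconst (he_int.const_mul _), hcI, integral_const_mul] at h
    exact h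
  -- (4) hypothesis: IL ≤ T E
  have h4 : IL ≤ T * E := by
    have h := hlow
    rw [timeMean, intervalIntegral.integral_of_le hTpos.le,
      inv_mul_le_iff₀ hTpos] at h
    exact h
  -- conclusion
  rw [timeMean, intervalIntegral.integral_of_le hTpos.le, inv_mul_le_iff₀ hTpos]
  have hcIG : c * IG ≤ 2⁻¹ * IG := mul_le_mul_of_nonneg_right hc hIG
  have hTE₀ : E₀ ≤ T * E₀ := le_mul_of_one_le_left hE₀ hT
  have hTF2 : 0 ≤ T * F2 := mul_nonneg hTpos.le hF2
  -- the goal's time integral is `IY` (the `set` abbreviation does not fold terms produced by `rw`)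
  show IY ≤ T * (4 * E + E₀ + F2)
  nlinarith [h1, h2, h3, h4, hcIG, hTE₀, hTF2, hIL, hIY]

/-- **Item 26917 `RootDecompCycle2B.TaylorBridge` holds**: loud stretches landed in Taylor boxes are landed, with the energy bound
`4E + E₀ + ‖f‖₂²`. [folklore] -/
theorem taylorBridge_holds : RootDecompCycle2B.TaylorBridge := by
  intro h
  obtain ⟨f, ν, E₀, E, ε, hdata, Kb, hKb, hall⟩ := h
  obtain ⟨hf, hdiv, hmean, hν, hν0, hε⟩ := hdata
  refine ⟨f, ν, E₀, 4 * E + E₀ + ∫ x, ‖f x‖ ^ 2, ε, ⟨hf, hdiv, hmean, hν, hν0, hε⟩, fun τ => ?_⟩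
  obtain ⟨j₀, hj⟩ := hall τ
  refine ⟨j₀, fun j hjj => ?_⟩
  obtain ⟨T₀, hT₀, K, u₀, u, hcap, hLH, hlow, hD⟩ := hj j hjj
  refine ⟨T₀, by linarith, K, u₀, u, hcap, hLH, fun T hT => ?_, hD⟩
  exact timeMean_energy_le_of_timeMean_lowEnergy_le (hν j) hf hmean hLH (hKb j) hcap (hT₀.trans hT) (hlow T hT)

end Summit.AnomalousDissipation.AnomalousDissipation.Theorems.TaylorBridge

end
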